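import Summits.QuantumFields.Balaban3D.Carriers.RT
import Summits.QuantumFields.Balaban3D.Proofs.RTAlgebra

/-!
# `Summit.QuantumFields.Balaban3D.Proofs.Transport48` — the display **(48)–(49)** of [Balaban1985UV3] pp. 267–268 in the lane's
# a.e. reading (rulings R-RN / R-48 / R-MASS / D-41′): applying the renormalization transformation `T` to the inductive bound (41)_k,
# inserting the decomposition of unity (7)–(8) at scale `k`, and splitting every new history into «the first expression (48)»
# (the transported MASS) times «The integral (49)» — carrier-parametric, so that the step leaf `Bound55` of the lane's tower
# REDUCES to ONE per-history fibre inequality ((49) ≤ (55)·(58), the (β) content of Sects. A/C) — lane `pub-balaban3d`, seat p4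

HONEST FRAMING (lane PLAN.md §0, binding): see `…Proofs.SectAFirstStep`.  This file is [folklore] measure theory over the tree's
push-forward reading of `T` (`Setup.IsRT`, LQB `AveragingRT.rnTransport`, seat p1's `Carriers.RT.AvgAC`); NOTHING of the saddle-point
computation (50)–(58) is proved here — it is the hypothesis `hfibre` of the main theorem, per new history, in transported form.

WHAT IS PRINTED (p. 267 L33–p. 268 L13, render p013/p014): «We apply the renormalization transformation T to the density ρ_k, and we
use the inductive inequality (41). Thus the density ρ_{k+1} is bounded by a sum of terms obtained by application of the renormalization
transformation T to terms on the right-hand side of (41). Now we do the same operations as in the first step. We introduce the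
decomposition of unity (7) for the field V on the domain Λ_k … We decompose the integral over V_k into two parts. The first is simply
the integral restricted to Z_k = B(Λ_{k+1})ᶜ, hence it defines the first expression (48) ∫dV_k↾_{Z_k} δ(V̄_kV^{−1})⋯ in the inductive
formula for k + 1. The second gives the integral (49) χ_{k+1} ∫dV_k↾_{B(Λ_{k+1})} δ(V̄_kV^{−1}) χ exp[−(1/g_k²)A^η(U_k) + ⋯], which we
have to calculate.»

THE LANE'S READING (D-41′, R-MASS ✓): `T_k` = the Radon–Nikodym transport `rnTransport Ū_k` (a dV-a.e. class); the inductive bound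
(41)_k is `ρ_k ≤ Σ_h m_k(h,·)·e^{F_k(h,·)}` with the masses `m` of seat p1's `Carriers.Masses` (`m_{k+1}(h′,V) = min 1 (T_k[w_k(h′)·
m_k(proj h′)](V))`, `w_k(h′) ∈ {0,1}` the step weight: large field on `P_k = last h′`, small field on `Λ_k(h′) = Ω_k∖Ω_{k+1}`); the
small-field factor `χ` INSIDE `B(Λ_{k+1})` rides with the exponential into «The integral (49)».

WHAT THIS FILE PROVES (no `sorry`, axioms standard), for a measurable HAAR-COMPATIBLE averaging (`Ū_*(dU) = dV`, true for the lane's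
axial averaging: LQB `AveragingRT.map_axialAvg`):
* §1 transport algebra in a.e. form: `isRT_one_of_map` (`T1 = 1`), `rnTransport_mono_ae` (`ρ₁ ≤ ρ₂ ⇒ Tρ₁ ≤ Tρ₂` a.e.),
  `rnTransport_sum_ae` (`T Σ = Σ T` a.e.), `rnTransport_le_one_ae` / `min_one_rnTransport_ae` (`0 ≤ φ ≤ 1 ⇒ Tφ ≤ 1` a.e., so the
  `min 1` pin of the mass recursion is a no-op a.e.) — from seat p4's `RTAlgebra` (`IsRT.ae_le`, `IsRT.sum`, `IsRT.ae_eq`) and seat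
  p1's `Carriers.RT` (`isRT_rnTransport_of_ac`, `integrable_rnTransport`);
* §2 **`transport41_le_sum_ae`** — (48)–(49) a.e.: IF `ρ ≤ Σ_h m₀(h)·e^{F₀(h)}` pointwise ((41)_k), the step weights `w(h′)·χB(h′)`
  of the new histories over each old one reach `1` where `m₀(h) ≠ 0` (decomposition of unity (7)–(8) at scale k: SOME new history above `h` has `w·χB ≥ 1`), the new masses
  dominate `T[w(h′)·m₀(proj h′)] ≤ m₁(h′)` a.e. (seat p1's `massRec_succ`/`massRec_triv` + `T1 = 1`), and FOR EVERY NEW HISTORY the fibre inequality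
  `T[w(h′)·χB(h′)·m₀(proj h′)·e^{F₀(proj h′)}] ≤ T[w(h′)·m₀(proj h′)]·B(h′)` holds dV-a.e. («The integral (49)» ≤ `B(h′)` = the
  (55)·(58) factor — THE (β) CONTENT, hypothesis `hfibre`), THEN `Tρ ≤ Σ_{h′} m₁(h′)·B(h′)` dV-a.e. — i.e. the right-hand side of
  LQB's `Bound55` for the lane's `LF = Σ_h m·exp` once `B = exp((55)+(58) exponent)`; the pointwise leaf then follows by seat p1's
  version selection (`Carriers.Run.run3_rho_succ_sandwich`, ruling R-RN) — see `…Proofs.Bound55Tower` / `…Proofs.Bound55Std`.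
-/

noncomputable section

namespace Summit.QuantumFields.Balaban3D.Proofs.Transport48

open _root_.MeasureTheory
open Literature.MathematicalPhysics.QuantumFieldTheory.Balaban1983to89
open Literature.MathematicalPhysics.QuantumFieldTheory.Balaban1983to89.AveragingRT (rnTransport rnTransport_nonneg)
open Summit.QuantumFields.Balaban3D.Carriers (AvgAC isRT_rnTransport_of_ac integrable_rnTransport measurable_rnTransport)
open Summit.QuantumFields.Balaban3D.Proofs.RTAlgebra

variable {P : Params} {j : ℕ} {G : Type*} [GaugeGroup G] [MeasurableSpace G] [HaarData G]
  {avg : GaugeField P j G → GaugeField P (j + 1) G}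

/-! ## §1 Transport algebra, dV-a.e. form -/

/-- A bounded measurable density on the (probability) field space is integrable. [folklore] -/
theorem integrable_of_bounds {k : ℕ} {φ : Density P k G} (hφ : Measurable φ) {a b : ℝ} (ha : ∀ U, a ≤ φ U) (hb : ∀ U, φ U ≤ b) :
    Integrable φ (fieldMeasure P k G) :=
  AveragingRT.integrable_of_abs_le hφ (max |a| |b|) fun U => by
    rw [abs_le]
    constructor
    · have := ha U; have := neg_abs_le a; linarith [le_max_left |a| |b|]
    · have := hb U; have := le_abs_self b; linarith [le_max_right |a| |b|]

/-- **`T1 = 1`** for a Haar-compatible averaging (`Ū_*(dU) = dV`): the constant density `1` is a renormalization transform of `1`. [folklore] -/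
theorem isRT_one_of_map (havg : Measurable avg) (hmap : (fieldMeasure P j G).map avg = fieldMeasure P (j + 1) G) :
    IsRT avg (fun _ => (1 : ℝ)) (fun _ => (1 : ℝ)) := by
  intro f hf _
  simp only [one_mul]
  rw [← hmap, integral_map havg.aemeasurable hf.aestronglyMeasurable]

/-- **T is monotone dV-a.e.** on integrable densities (the «≤» of (48)): `ρ₁ ≤ ρ₂ ⇒ Tρ₁ ≤ Tρ₂` a.e. [cite: Balaban1985UV3, (48) p.267] -/
theorem rnTransport_mono_ae (h : AvgAC avg) {ρ₁ ρ₂ : Density P j G} (hle : ∀ U, ρ₁ U ≤ ρ₂ U)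
    (hi₁ : Integrable ρ₁ (fieldMeasure P j G)) (hi₂ : Integrable ρ₂ (fieldMeasure P j G)) :
    rnTransport avg ρ₁ ≤ᵐ[fieldMeasure P (j + 1) G] rnTransport avg ρ₂ :=
  IsRT.ae_le (isRT_rnTransport_of_ac h ρ₁ hi₁) (isRT_rnTransport_of_ac h ρ₂ hi₂) hle h.measurable hi₁ hi₂
    (integrable_rnTransport avg ρ₁ hi₁) (integrable_rnTransport avg ρ₂ hi₂)

/-- **T of a finite sum is the sum of the T's, dV-a.e.** (p. 267 L34–35 «a sum of terms obtained by application of the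
renormalization transformation T to terms»). [cite: Balaban1985UV3, (48) p.267] -/
theorem rnTransport_sum_ae (h : AvgAC avg) {ι : Type*} (s : Finset ι) (ρ : ι → Density P j G)
    (hi : ∀ i ∈ s, Integrable (ρ i) (fieldMeasure P j G)) :
    rnTransport avg (fun U => ∑ i ∈ s, ρ i U) =ᵐ[fieldMeasure P (j + 1) G] fun V => ∑ i ∈ s, rnTransport avg (ρ i) V :=
  IsRT.ae_eq (isRT_rnTransport_of_ac h _ (integrable_finsetSum s hi))
    (IsRT.sum s (fun i hi0 => isRT_rnTransport_of_ac h (ρ i) (hi i hi0)) h.measurable hi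
      (fun i hi0 => integrable_rnTransport avg (ρ i) (hi i hi0)))
    h.measurable (integrable_finsetSum s hi) (integrable_rnTransport avg _ (integrable_finsetSum s hi))
    (integrable_finsetSum s fun i hi0 => integrable_rnTransport avg (ρ i) (hi i hi0))

/-- **`0 ≤ φ ≤ 1 ⇒ Tφ ≤ 1` dV-a.e.** for a Haar-compatible averaging (monotonicity against `T1 = 1`). [folklore] -/
theorem rnTransport_le_one_ae (havg : Measurable avg) (hmap : (fieldMeasure P j G).map avg = fieldMeasure P (j + 1) G)
    {φ : Density P j G} (hφ : Measurable φ) (h0 : ∀ U, 0 ≤ φ U) (h1 : ∀ U, φ U ≤ 1) :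
    rnTransport avg φ ≤ᵐ[fieldMeasure P (j + 1) G] fun _ => (1 : ℝ) := by
  have hi : Integrable φ (fieldMeasure P j G) := integrable_of_bounds hφ h0 h1
  exact IsRT.ae_le (isRT_rnTransport_of_ac (AvgAC.of_map_eq havg hmap) φ hi) (isRT_one_of_map havg hmap) h1 havg hi
    (integrable_const _) (integrable_rnTransport avg φ hi) (integrable_const _)

/-- The `min 1` pin of the mass recursion is a no-op dV-a.e.: `min 1 (Tφ) = Tφ` a.e. for `0 ≤ φ ≤ 1`. [folklore] -/
theorem min_one_rnTransport_ae (havg : Measurable avg) (hmap : (fieldMeasure P j G).map avg = fieldMeasure P (j + 1) G)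
    {φ : Density P j G} (hφ : Measurable φ) (h0 : ∀ U, 0 ≤ φ U) (h1 : ∀ U, φ U ≤ 1) :
    (fun V => min 1 (rnTransport avg φ V)) =ᵐ[fieldMeasure P (j + 1) G] rnTransport avg φ := by
  filter_upwards [rnTransport_le_one_ae havg hmap hφ h0 h1] with V hV
  exact min_eq_right hV


/-- SUFFICIENT CONDITION for the integrability hypotheses `hint`/`hint47` of `…Bound55Tower`/`…Bound55Std` (the (41)_k / (47)_k sides):
a `[0,1]`-valued measurable weight times `exp` of a measurable exponent BOUNDED ABOVE is integrable on the (probability) field space —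
e.g. `F = −(1/g_k²)A^η(U_k) + Σ𝒫_j − E_k + …` with `A^η ≥ 0` and bounded interaction data. [folklore] -/
theorem integrable_weight_mul_exp {k : ℕ} {m F : Density P k G} (hm : Measurable m) (hm0 : ∀ U, 0 ≤ m U) (hm1 : ∀ U, m U ≤ 1)
    (hF : Measurable F) {c : ℝ} (hFc : ∀ U, F U ≤ c) :
    Integrable (fun U => m U * Real.exp (F U)) (fieldMeasure P k G) :=
  integrable_of_bounds (hm.mul (Real.measurable_exp.comp hF)) (a := 0) (b := Real.exp c)
    (fun U => mul_nonneg (hm0 U) (Real.exp_pos _).le)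
    (fun U => by
      calc m U * Real.exp (F U) ≤ 1 * Real.exp c :=
            mul_le_mul (hm1 U) (Real.exp_le_exp.mpr (hFc U)) (Real.exp_pos _).le zero_le_one
        _ = Real.exp c := one_mul _)

/-! ## §2 (48)–(49): the transported inductive bound splits over the new histories -/

section Main

variable {H₀ H₁ : Type*} [Fintype H₀] [Fintype H₁]

/-- The product of two `[0,1]`-valued weights is a `[0,1]`-valued weight; with a third bounded measurable factor the product of
an integrable density stays integrable. [folklore] -/
theorem integrable_weight_mul {w χ : Density P j G} {φ : Density P j G} (hw : Measurable w) (hχ : Measurable χ)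
    (hw0 : ∀ U, 0 ≤ w U) (hw1 : ∀ U, w U ≤ 1) (hχ0 : ∀ U, 0 ≤ χ U) (hχ1 : ∀ U, χ U ≤ 1)
    (hφ : Integrable φ (fieldMeasure P j G)) :
    Integrable (fun U => w U * χ U * φ U) (fieldMeasure P j G) := by
  refine hφ.bdd_mul ((hw.mul hχ).aestronglyMeasurable) (c := 1) (Filter.Eventually.of_forall fun U => ?_)
  rw [Real.norm_eq_abs, abs_mul, abs_of_nonneg (hw0 U), abs_of_nonneg (hχ0 U)]
  calc w U * χ U ≤ 1 * 1 := mul_le_mul (hw1 U) (hχ1 U) (hχ0 U) zero_le_one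
    _ = 1 := one_mul 1

/-- **(48)–(49) dV-a.e.** ([Balaban1985UV3] p. 267 L33–p. 268 L13, in the lane's reading R-RN/R-48/R-MASS/D-41′).  Fine lattice `j`
(= scale k), averaging `Ū` measurable and Haar-compatible; old histories `H₀`, new histories `H₁` with `proj`; `ρ` = ρ_k (integrable);
`m₀ h`, `F₀ h` = the masses and exponents of (41)_k (hypothesis `h41`); `w h′ ∈ [0,1]` the step weights and `χB h′ ∈ [0,1]` the
small-field factors inside `B(Λ_{k+1}(h′))` of the decomposition of unity (7)–(8) at scale k, with SOME new history above
`h` of full weight `w·χB ≥ 1` wherever `m₀(h) ≠ 0` (`hcover`: «the» large-field set of the configuration); `T[w(h′)·m₀(proj h′)] ≤ m₁ h′` a.e. for the new masses (`hm₁`: seat p1's `Carriers.Masses.massRec_succ`/`massRec_triv` with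
`T1 = 1`); `B ≥ 0`; and, per new history, THE FIBRE INEQUALITY `hfibre`: `T[w·χB·m₀(proj h′)·e^{F₀(proj h′)}] ≤
T[w·m₀(proj h′)]·B(h′)` a.e. — «The integral (49)» bounded by the (55)·(58) factor `B(h′)`, the (β) content of
Sect. A ((12)–(22)) / Sect. C ((50)–(58)) NOT proved here.  THEN `Tρ ≤ Σ_{h′} m₁(h′)·B(h′)` dV-a.e.  Proof: `T` monotone and
additive a.e. (§1), the pointwise insertion `m₀(h)e^{F₀(h)} ≤ Σ_{h′ ↦ h} w χB m₀ e^{F₀}`, `hfibre`, `hm₁`, and re-indexation of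
`Σ_h Σ_{h′ ↦ h}` as `Σ_{h′}`. [cite: Balaban1985UV3, (48)–(49) pp.267–268] -/
theorem transport41_le_sum_ae (havg : Measurable avg) (hmap : (fieldMeasure P j G).map avg = fieldMeasure P (j + 1) G)
    (proj : H₁ → H₀) (ρ : Density P j G) (hρ : Integrable ρ (fieldMeasure P j G))
    (m₀ : H₀ → Density P j G) (F₀ : H₀ → GaugeField P j G → ℝ)
    (w χB : H₁ → Density P j G) (m₁ B : H₁ → Density P (j + 1) G)
    (h41 : ∀ U, ρ U ≤ ∑ h, m₀ h U * Real.exp (F₀ h U))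
    (hint : ∀ h, Integrable (fun U => m₀ h U * Real.exp (F₀ h U)) (fieldMeasure P j G))
    (hm₀0 : ∀ h U, 0 ≤ m₀ h U)
    (hw : ∀ h', Measurable (w h')) (hw0 : ∀ h' U, 0 ≤ w h' U) (hw1 : ∀ h' U, w h' U ≤ 1)
    (hχ : ∀ h', Measurable (χB h')) (hχ0 : ∀ h' U, 0 ≤ χB h' U) (hχ1 : ∀ h' U, χB h' U ≤ 1)
    (hcover : ∀ h U, m₀ h U ≠ 0 → ∃ h', proj h' = h ∧ (1 : ℝ) ≤ w h' U * χB h' U)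
    (hm₁ : ∀ h', (rnTransport avg fun U => w h' U * m₀ (proj h') U) ≤ᵐ[fieldMeasure P (j + 1) G] m₁ h')
    (hB : ∀ h' V, 0 ≤ B h' V)
    (hfibre : ∀ h', (rnTransport avg (fun U => w h' U * χB h' U * (m₀ (proj h') U * Real.exp (F₀ (proj h') U))))
      ≤ᵐ[fieldMeasure P (j + 1) G] fun V => rnTransport avg (fun U => w h' U * m₀ (proj h') U) V * B h' V) :
    rnTransport avg ρ ≤ᵐ[fieldMeasure P (j + 1) G] fun V => ∑ h', m₁ h' V * B h' V := by
  classical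
  have hac : AvgAC avg := AvgAC.of_map_eq havg hmap
  -- the summands of (41)_k and their refinements over the new histories
  set R : Density P j G := fun U => ∑ h, m₀ h U * Real.exp (F₀ h U) with hR
  set g : H₁ → Density P j G := fun h' U => w h' U * χB h' U * (m₀ (proj h') U * Real.exp (F₀ (proj h') U)) with hg
  have hRi : Integrable R (fieldMeasure P j G) := integrable_finsetSum _ fun h _ => hint h
  have hgi : ∀ h', Integrable (g h') (fieldMeasure P j G) := fun h' =>
    integrable_weight_mul (hw h') (hχ h') (hw0 h') (hw1 h') (hχ0 h') (hχ1 h') (hint (proj h'))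
  have hg0 : ∀ h' U, 0 ≤ g h' U := fun h' U =>
    mul_nonneg (mul_nonneg (hw0 h' U) (hχ0 h' U)) (mul_nonneg (hm₀0 _ U) (Real.exp_pos _).le)
  -- Step A: `Tρ ≤ T R` a.e.
  have hA : rnTransport avg ρ ≤ᵐ[fieldMeasure P (j + 1) G] rnTransport avg R := rnTransport_mono_ae hac h41 hρ hRi
  -- Step B: `T R = Σ_h T(m₀ h e^{F₀ h})` a.e.
  have hBsum : rnTransport avg R =ᵐ[fieldMeasure P (j + 1) G]
      fun V => ∑ h, rnTransport avg (fun U => m₀ h U * Real.exp (F₀ h U)) V :=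
    rnTransport_sum_ae hac Finset.univ (fun h U => m₀ h U * Real.exp (F₀ h U)) fun h _ => hint h
  -- Step C: for each old history, insert the decomposition of unity and transport
  have hC : ∀ h, rnTransport avg (fun U => m₀ h U * Real.exp (F₀ h U)) ≤ᵐ[fieldMeasure P (j + 1) G]
      rnTransport avg (fun U => ∑ h' ∈ Finset.univ.filter (fun h' => proj h' = h), g h' U) := fun h => by
    refine rnTransport_mono_ae hac (fun U => ?_) (hint h) (integrable_finsetSum _ fun h' _ => hgi h')
    by_cases hm : m₀ h U = 0
    · rw [hm, zero_mul]; exact Finset.sum_nonneg fun h' _ => hg0 h' U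
    · have hpos : 0 ≤ m₀ h U * Real.exp (F₀ h U) := mul_nonneg (hm₀0 h U) (Real.exp_pos _).le
      have hsum : ∑ h' ∈ Finset.univ.filter (fun h' => proj h' = h), g h' U
          = (∑ h' ∈ Finset.univ.filter (fun h' => proj h' = h), w h' U * χB h' U) * (m₀ h U * Real.exp (F₀ h U)) := by
        rw [Finset.sum_mul]
        refine Finset.sum_congr rfl fun h' hh' => ?_
        rw [Finset.mem_filter] at hh'
        rw [hg]; simp only [hh'.2]
      rw [hsum]
      obtain ⟨h₁, hh₁, hone⟩ := hcover h U hm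
      have hcov : (1 : ℝ) ≤ ∑ h' ∈ Finset.univ.filter (fun h' => proj h' = h), w h' U * χB h' U :=
        hone.trans (Finset.single_le_sum (f := fun h' => w h' U * χB h' U)
          (fun h' _ => mul_nonneg (hw0 h' U) (hχ0 h' U)) (Finset.mem_filter.mpr ⟨Finset.mem_univ _, hh₁⟩))
      calc m₀ h U * Real.exp (F₀ h U) = 1 * (m₀ h U * Real.exp (F₀ h U)) := (one_mul _).symm
        _ ≤ _ := mul_le_mul_of_nonneg_right hcov hpos
  -- Step D: split the transported refined sum
  have hD : ∀ h, rnTransport avg (fun U => ∑ h' ∈ Finset.univ.filter (fun h' => proj h' = h), g h' U)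
      =ᵐ[fieldMeasure P (j + 1) G] fun V => ∑ h' ∈ Finset.univ.filter (fun h' => proj h' = h), rnTransport avg (g h') V :=
    fun h => rnTransport_sum_ae hac _ g fun h' _ => hgi h'
  -- Step F: the transported weighted mass is below the new mass a.e. (`hm₁`)
  -- gather the finitely many a.e. statements
  have hC' := ae_all_iff.mpr hC
  have hD' := ae_all_iff.mpr hD
  have hE' := ae_all_iff.mpr hfibre
  have hF' := ae_all_iff.mpr hm₁
  filter_upwards [hA, hBsum, hC', hD', hE', hF'] with V hA hBsum hC hD hE hF
  calc rnTransport avg ρ V ≤ rnTransport avg R V := hA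
    _ = ∑ h, rnTransport avg (fun U => m₀ h U * Real.exp (F₀ h U)) V := hBsum
    _ ≤ ∑ h, ∑ h' ∈ Finset.univ.filter (fun h' => proj h' = h), rnTransport avg (g h') V :=
        Finset.sum_le_sum fun h _ => (hC h).trans (le_of_eq (hD h))
    _ ≤ ∑ h, ∑ h' ∈ Finset.univ.filter (fun h' => proj h' = h), m₁ h' V * B h' V := by
        refine Finset.sum_le_sum fun h _ => Finset.sum_le_sum fun h' _ => ?_
        calc rnTransport avg (g h') V ≤ rnTransport avg (fun U => w h' U * m₀ (proj h') U) V * B h' V := hE h'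
          _ ≤ m₁ h' V * B h' V := mul_le_mul_of_nonneg_right (hF h') (hB h' V)
    _ = ∑ h', m₁ h' V * B h' V := Finset.sum_fiberwise Finset.univ proj fun h' => m₁ h' V * B h' V

end Main

end Summit.QuantumFields.Balaban3D.Proofs.Transport48

end
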